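import Summits.BirchSwinnertonDyer.BirchSwinnertonDyer.Theorems.CumulativeHeegnerLeopoldtRedSplitControlAtThreeShaTwoReadoutRoadPresentation
import Summits.BirchSwinnertonDyer.BirchSwinnertonDyer.Theorems.ThetaPartnerAtTwoSignedControlAtTwoMuRealShaDualCanonical
import HarnessLib

/-!
# Poitou–Tate, degree two, at fields WITH REAL PLACES: the `Ш²`-readout road of cell `bsd-wall` (seat `bsd-line-chl-p2`)
# WITHOUT `IsTotallyComplex` — archimedean components live (Milne ADT I Thm. 4.10 (a), proof p. 58)

Crux K4 `SignedControlAtTwo` (stmt-BirchSwinnertonDyer-20309; routes `ThetaPartnerAtTwo` / `ResidualThetaTransportAtTwo`), line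
`eulerchar` v13 (lead `bsd-wall-tp2-p3` g5); seat `bsd-inputs-k4-p1` (D-0154 (2) "prove the printed input", `--supports
stmt-BirchSwinnertonDyer-20309`, helper; CONDITIONAL).  The registered stub `stub_poitouTateShaRat : poitouTate_sha_tateDual ℚ`
is Milne I Thm. 4.10 (a) over `K = ℚ` — a field with a REAL place.  The tree's degree-`2` road to that named fact
(`PoitouTateShaTwoReadout.shaTwo_tateDual_of_presentation_readout`, `…_of_ideleProjection`, `…_of_shaTwoConnecting`,
`poitouTate_sha_tateDual_of_localGlobal`; seat `bsd-line-chl-p2` g6/g7, whose consumer K4 `RedSplitControlAtThree` lives at a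
totally complex field) carries the instance hypothesis `[IsTotallyComplex K]`, used ONLY in its last step (seat chl-p2 g5's
`PoitouTateShaAnnihilator.sha_tateDual_of_readout`, which kills the archimedean components).  Lead `bsd-wall-tp2-p3` g4 proved
that last step for EVERY number field (`SignedEC.MuReal.sha_tateDual_of_readout_real`, from the archimedean local Tate duality
Milne I Thm. 2.13 (a) and `LocalInvariants.canonical_injectiveAtRealPlaces`).  This file splices the two:

* **`shaTwo_tateDual_of_presentation_readout_real`** — verbatim the hypotheses of chl-p2 g6's
  `shaTwo_tateDual_of_presentation_readout` MINUS `[IsTotallyComplex K]`, same conclusion (`Ш²(K, M)` finite and perfectly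
  paired with `Ш¹(K, M^D)` into `ℤ/n`).  The construction of the readout `e(c) = (ℤ/n ↪ ℚ/ℤ)⁻¹ ∘ (y ↦ inv(nat y ∘ ∂ h_c))` and
  of its three properties is the road's (its injectivity clause never used the vanishing of the archimedean components of
  the test family); the perfect pairing is then `sha_tateDual_of_readout_real` for the canonical invariant maps.
* **`shaTwo_tateDual_of_ideleProjection_real`** — the same RUN on door-c4's canonical presentation
  (`FreePresentation.presentationComplex ρ₀`, module `ρ₀^D`, idèle readout `HomDual.readout ρ₀ n hM (π v)`), `hα` and (∂)
  discharged exactly as in `shaTwo_tateDual_of_ideleProjection` (`tateDuality_finite`, `ext_presLattice_classBarD_eq_zero`).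

HONEST FRAMING. THEOREMS ONLY (no definition, no named fact, no `sorry`); a reduction — (R3), `nat`/(R4), the five
properties of `Ψ` and `SelmerComplement` are displayed hypotheses on existing objects (cell `bsd-schneider` doors c4/c5/c6 and
seat chl-p2 are landing them); closes no item; no case of Poitou–Tate or BSD is proved here.

References: [MilneADT2006] I Thm. 4.10 (a) and its proof (p. 58), Thm. 2.13 (a), Lemma 4.13, Thm. 1.8, Ex. 1.6 (c);
[Harari2020] Thm. 17.13 (b), §16.3; [CasselsFrohlichANT1967] Ch. VII §9 Thm. 9.1.
-/

noncomputable section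

open Function NumberField IsDedekindDomain CategoryTheory CategoryTheory.Abelian
open scoped NumberField

set_option linter.dupNamespace false
set_option autoImplicit false

namespace Summit.BirchSwinnertonDyer.BirchSwinnertonDyer.Theorems.PoitouTateShaTwoReadout

open Field
open Literature.NumberTheory.GaloisRepresentations Literature.NumberTheory.GaloisCohomology
open Literature.NumberTheory.GaloisRepresentations.DiscreteGaloisModule (TateDual tateDual localTatePairingZMod
  unramifiedSubgroup sha shaTwo)
open Literature.Algebra.Homology Literature.Algebra.Homology.DiscreteRep Literature.Algebra.Homology.ExtPresentation
open Literature.NumberTheory.GaloisRepresentations.IdeleClassBar (classBarD)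
open Literature.AnabelianGeometry.AbsoluteAnabelian.Prop121vii (zmodToQmodZ zmodToQmodZ_injective)
open Summit.BirchSwinnertonDyer.BirchSwinnertonDyer.Theorems.SignedEC.MuReal (sha_tateDual_of_readout_real)
open Summit.BirchSwinnertonDyer.BirchSwinnertonDyer.Theorems.SchneiderFreeAdditiveX3.PoitouTateReduction
  (unramifiedOrthogonal_of_isPerfect_allLevels)
open Summit.BirchSwinnertonDyer.BirchSwinnertonDyer.Theorems.KolyvaginRoadThreePT
  (exists_finset_localization_mem_unramifiedSubgroup)

/-! ## §1 The `Ш²`-readout road, any number field -/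

section Road

variable {K : Type} [Field K] [NumberField K]

/-- **Milne I Thm. 4.10 (a) at one module from the presentation road plus a degree-`2` obstruction map — ANY number field
(real places allowed).**  `n ≥ 1`, `ρ` a finite discrete `n`-torsion `Γ_K`-module unramified off the finite
`S₀ ⊇ {v ∣ ∞} ∪ {v ∣ n}`, `Ш¹(K, M^D)` finite; the canonical local invariant maps satisfy `SelmerComplement` at level `n`
(= the output of `hE(n)`).  Given the degree-`≤ 1` package of the presentation road — an invariant map `inv` of `C̄`, a short
exact `S : 0 → N₁ → N₂ → N → 0` in `C_Γ` with `α¹(Γ_K, N)` bijective and `Ext¹(N₂, C̄) = 0`, a readout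
`R_v : Hom(N₁, J̄) → H¹(K_v, M)` with the surjectivity (R3) (ALL places), and an additive bijection `nat : H¹(K, M^D) ≅ Ext¹(ℤ, N)`
with the pairing identity (R4) `(1/n)·∑_{v ∈ T'} inv_v(R_v f ∪ loc_v y) = inv(nat y ∘ ∂(f ≫ g))` (archimedean summands
included) — and the degree-`2` package — an additive `Ψ : Hom(N₁, C̄) → H²(K, M)` with `Ψ(f ≫ g) = 0`, `Ψ(ι ≫ q) = 0`,
`Ψ h = 0 ⟹ h = f ≫ g`, `Ψ h ∈ Ш²(K, M)`, `Ш²(K, M) ⊆ Im Ψ` — the group `Ш²(K, M)` is finite and there is a bi-additive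
`b : Ш²(K, M) × Ш¹(K, M^D) → ℤ/n` both of whose adjoints are bijective (verbatim the conclusion of `poitouTate_sha_tateDual K`
at `(n, M, ρ)`).  Proof: the readout `e` and its additivity / injectivity / surjectivity modulo sums of local Tate pairings
are constructed exactly as in `shaTwo_tateDual_of_presentation_readout` (archimedean components of the test families live);
the pairing is `SignedEC.MuReal.sha_tateDual_of_readout_real` for `LocalInvariants.canonical K n`
(`canonical_isPerfect`, `canonical_injectiveAtRealPlaces`, Milne I 2.6 at all levels, `SelmerComplement`).
[cite: MilneADT2006, Ch. I, Thm. 4.10 (a) (proof, p. 58), Thm. 2.13 (a), Lemma 4.13, Thm. 1.8][cite: Harari2020, Thm. 17.13 (b), §16.3] -/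
theorem shaTwo_tateDual_of_presentation_readout_real {n : ℕ} [NeZero n]
    (hcomp : (LocalInvariants.canonical K n).SelmerComplement)
    {M : Type} [AddCommGroup M] [TopologicalSpace M] [DiscreteTopology M] [Finite M]
    (ρ : DiscreteGaloisModule K M) (hM : ∀ m : M, n • m = 0)
    (S₀ : Finset (Place K)) (hinf : ∀ w : InfinitePlace K, (Sum.inl w : Place K) ∈ S₀)
    (hS₀ : ∀ v : HeightOneSpectrum (𝓞 K), (Sum.inr v : Place K) ∉ S₀ →
      ((n : ℕ) : 𝓞 K) ∉ v.asIdeal ∧ GaloisRep.IsUnramifiedAt v ρ)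
    [Finite (sha (ρ.tateDual n))]
    (inv : Abelian.Ext (triv (Γ := absoluteGaloisGroup K) ℤ) (classBarD K) 2 →+ AddCircle (1 : ℚ))
    {S : ShortComplex (DiscreteRepCat ℤ (absoluteGaloisGroup K))} (hS : S.ShortExact)
    (hα : Function.Bijective
      (ExtDuality.adjointMap (P := triv (Γ := absoluteGaloisGroup K) ℤ) inv S.X₃ (rfl : 1 + 1 = 2)))
    (hPC : ∀ x : Abelian.Ext S.X₂ (classBarD K) 1, x = 0)
    (R : ∀ v : Place K, (S.X₁ ⟶ (ideleClassLimitShortComplex K).X₂) →+ galoisCohomology (ρ.toLocal v) 1)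
    (hR3 : ∀ T : Finset (Place K), (∀ w : InfinitePlace K, (Sum.inl w : Place K) ∈ T) →
      (∀ v : HeightOneSpectrum (𝓞 K), (Sum.inr v : Place K) ∉ T →
        ((n : ℕ) : 𝓞 K) ∉ v.asIdeal ∧ GaloisRep.IsUnramifiedAt v ρ) →
      ∀ t : Π v : Place K, galoisCohomology (ρ.toLocal v) 1,
        (∀ v : HeightOneSpectrum (𝓞 K), (Sum.inr v : Place K) ∉ T →
          t (Sum.inr v) ∈ unramifiedSubgroup (GaloisRep.toLocal v ρ) 1) →
        ∃ f : S.X₁ ⟶ (ideleClassLimitShortComplex K).X₂, ∀ v : Place K, R v f = t v)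
    (nat : galoisCohomology (ρ.tateDual n) 1 →+ Abelian.Ext (triv (Γ := absoluteGaloisGroup K) ℤ) S.X₃ 1)
    (hnat : Function.Bijective nat)
    (hR4 : ∀ f : S.X₁ ⟶ (ideleClassLimitShortComplex K).X₂, ∃ Tf : Finset (Place K),
      ∀ (y : galoisCohomology (ρ.tateDual n) 1) (T' : Finset (Place K)), Tf ⊆ T' →
        (∀ v : HeightOneSpectrum (𝓞 K), (Sum.inr v : Place K) ∉ T' →
          galoisCohomology.localization (ρ.tateDual n) (Sum.inr v) 1 y ∈
            unramifiedSubgroup (GaloisRep.toLocal v (ρ.tateDual n)) 1) →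
        zmodToQmodZ n (∑ v ∈ T', localTatePairingZMod ρ n v (LocalInvariants.canonical K n v) (R v f)
          (galoisCohomology.localization (ρ.tateDual n) v 1 y)) =
        inv ((nat y).comp (boundary hS (classBarD K) (f ≫ (ideleClassLimitShortComplex K).g))
          (rfl : 1 + 1 = 2)))
    (Ψ : (S.X₁ ⟶ classBarD K) →+ galoisCohomology ρ 2)
    (hΨg : ∀ f : S.X₁ ⟶ (ideleClassLimitShortComplex K).X₂, Ψ (f ≫ (ideleClassLimitShortComplex K).g) = 0)
    (hΨf : ∀ q : S.X₂ ⟶ classBarD K, Ψ (S.f ≫ q) = 0)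
    (hΨker : ∀ h : S.X₁ ⟶ classBarD K, Ψ h = 0 →
      ∃ f : S.X₁ ⟶ (ideleClassLimitShortComplex K).X₂, h = f ≫ (ideleClassLimitShortComplex K).g)
    (hΨsha : ∀ h : S.X₁ ⟶ classBarD K, Ψ h ∈ shaTwo ρ)
    (hΨsurj : ∀ c ∈ shaTwo ρ, ∃ h : S.X₁ ⟶ classBarD K, Ψ h = c) :
    Finite (shaTwo ρ) ∧ ∃ b : shaTwo ρ →+ sha (ρ.tateDual n) →+ ZMod n,
      Function.Bijective b ∧ Function.Bijective b.flip := by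
  classical
  -- `H¹(K, M^D)` is `n`-torsion
  have hN1 : ∀ y : galoisCohomology (ρ.tateDual n) 1, n • y = 0 := fun y =>
    galoisCohomology.nsmul_eq_zero_of_forall _ (fun f => DiscreteGaloisModule.TateDual.nsmul_eq_zero f) y
  -- the bridge as an additive equivalence
  let natE : galoisCohomology (ρ.tateDual n) 1 ≃+
      Abelian.Ext (triv (Γ := absoluteGaloisGroup K) ℤ) S.X₃ 1 := AddEquiv.ofBijective nat hnat
  have hnatE : ∀ y, natE y = nat y := fun _ => rfl
  -- the `ℚ/ℤ`-valued functional `y ↦ inv (nat y ∘ ∂ h)` of a homomorphism `h : N₁ → C̄`, additive in `h`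
  let EH : (S.X₁ ⟶ classBarD K) →+ (galoisCohomology (ρ.tateDual n) 1 →+ AddCircle (1 : ℚ)) :=
    AddMonoidHom.mk' (fun h =>
      (ExtDuality.adjointMap (P := triv (Γ := absoluteGaloisGroup K) ℤ) inv S.X₃ (rfl : 1 + 1 = 2)
        (boundary hS (classBarD K) h)).comp nat)
      (fun h h' => by rw [map_add, map_add, AddMonoidHom.add_comp])
  have hEH : ∀ (h : S.X₁ ⟶ classBarD K) (y : galoisCohomology (ρ.tateDual n) 1),
      EH h y = inv ((nat y).comp (boundary hS (classBarD K) h) (rfl : 1 + 1 = 2)) := fun _ _ => rfl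
  -- its `ℤ/n`-valued lift
  have hfac : ∀ h : S.X₁ ⟶ classBarD K, ∃ φ : galoisCohomology (ρ.tateDual n) 1 →+ ZMod n,
      ∀ y, zmodToQmodZ n (φ y) = EH h y := fun h => exists_addMonoidHom_zmodToQmodZ_eq hN1 (EH h)
  choose eh heh using hfac
  have heh_sub : ∀ (h h' : S.X₁ ⟶ classBarD K) (y : galoisCohomology (ρ.tateDual n) 1),
      eh (h - h') y = eh h y - eh h' y := fun h h' y => by
    apply zmodToQmodZ_injective n
    rw [map_sub, heh, heh, heh, map_sub, AddMonoidHom.sub_apply]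
  -- lifts of the `Ш²`-classes along `Ψ`
  choose lift hlift using hΨsurj
  -- THE READOUT
  let e : shaTwo ρ → (galoisCohomology (ρ.tateDual n) 1 →+ ZMod n) := fun c => eh (lift c.1 c.2)
  have he : ∀ c : shaTwo ρ, e c = eh (lift c.1 c.2) := fun _ => rfl
  -- the functional of `f ≫ g` is a local sum: (R4), read in `ℤ/n`
  have hloc : ∀ f : S.X₁ ⟶ (ideleClassLimitShortComplex K).X₂, ∃ Tf : Finset (Place K),
      ∀ (y : galoisCohomology (ρ.tateDual n) 1) (T' : Finset (Place K)), Tf ⊆ T' →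
        (∀ v : HeightOneSpectrum (𝓞 K), (Sum.inr v : Place K) ∉ T' →
          galoisCohomology.localization (ρ.tateDual n) (Sum.inr v) 1 y ∈
            unramifiedSubgroup (GaloisRep.toLocal v (ρ.tateDual n)) 1) →
        eh (f ≫ (ideleClassLimitShortComplex K).g) y =
          ∑ v ∈ T', localTatePairingZMod ρ n v (LocalInvariants.canonical K n v) (R v f)
            (galoisCohomology.localization (ρ.tateDual n) v 1 y) := by
    intro f
    obtain ⟨Tf, hTf⟩ := hR4 f
    refine ⟨Tf, fun y T' hT' hy => ?_⟩
    apply zmodToQmodZ_injective n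
    rw [heh, hEH, hTf y T' hT' hy]
  -- every class is unramified off a finite set of places
  have hur_y : ∀ (y : galoisCohomology (ρ.tateDual n) 1) (T₀ : Finset (Place K)), ∃ T' : Finset (Place K),
      T₀ ⊆ T' ∧ ∀ v : HeightOneSpectrum (𝓞 K), (Sum.inr v : Place K) ∉ T' →
        galoisCohomology.localization (ρ.tateDual n) (Sum.inr v) 1 y ∈
          unramifiedSubgroup (GaloisRep.toLocal v (ρ.tateDual n)) 1 := by
    intro y T₀
    obtain ⟨Ty, hTy⟩ := exists_finset_localization_mem_unramifiedSubgroup (ρ.tateDual n) y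
    refine ⟨T₀ ∪ Ty.image Sum.inr, Finset.subset_union_left, fun v hv => hTy v fun hvT => hv ?_⟩
    exact Finset.mem_union_right _ (Finset.mem_image_of_mem _ hvT)
  -- two homomorphisms with the same functional differ by `ι ≫ q`, so have the same `Ψ`
  have hΨ_eq_of_EH : ∀ h h' : S.X₁ ⟶ classBarD K, EH h = EH h' → Ψ h = Ψ h' := by
    intro h h' hhh
    have h1 : ExtDuality.adjointMap (P := triv (Γ := absoluteGaloisGroup K) ℤ) inv S.X₃ (rfl : 1 + 1 = 2)
        (boundary hS (classBarD K) h) =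
        ExtDuality.adjointMap (P := triv (Γ := absoluteGaloisGroup K) ℤ) inv S.X₃ (rfl : 1 + 1 = 2)
        (boundary hS (classBarD K) h') :=
      (AddMonoidHom.cancel_right hnat.2).1 hhh
    have h2 : boundary hS (classBarD K) h = boundary hS (classBarD K) h' := hα.1 h1
    obtain ⟨q, hq⟩ := (boundary_eq_boundary_iff hS h h').1 h2
    rw [hq, map_add, hΨf, add_zero]
  -- (add): `e` is additive modulo local sums
  have hadd : ∀ c c' : shaTwo ρ, ∃ (S₁ : Finset (Place K)) (t : Π v : Place K, galoisCohomology (ρ.toLocal v) 1),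
      ∀ (y : galoisCohomology (ρ.tateDual n) 1) (S' : Finset (Place K)), S₁ ⊆ S' →
        (∀ v : HeightOneSpectrum (𝓞 K), (Sum.inr v : Place K) ∉ S' →
          galoisCohomology.localization (ρ.tateDual n) (Sum.inr v) 1 y ∈
            unramifiedSubgroup (GaloisRep.toLocal v (ρ.tateDual n)) 1) →
        (e (c + c') - e c - e c') y = ∑ v ∈ S', localTatePairingZMod ρ n v (LocalInvariants.canonical K n v) (t v)
          (galoisCohomology.localization (ρ.tateDual n) v 1 y) := by
    intro c c'
    set d : S.X₁ ⟶ classBarD K := lift (c + c').1 (c + c').2 - lift c.1 c.2 - lift c'.1 c'.2 with hd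
    have hΨd : Ψ d = 0 := by
      rw [hd, map_sub, map_sub, hlift, hlift, hlift, AddSubgroup.coe_add, add_sub_cancel_left, sub_self]
    obtain ⟨f, hf⟩ := hΨker d hΨd
    obtain ⟨Tf, hTf⟩ := hloc f
    refine ⟨Tf, fun v => R v f, fun y S' hS' hy => ?_⟩
    rw [AddMonoidHom.sub_apply, AddMonoidHom.sub_apply, he, he, he, ← heh_sub, ← heh_sub, ← hd, hf]
    exact hTf y S' hS' hy
  -- (inj): a class whose readout is a local sum vanishes (archimedean components of the test family live)
  have hinj : ∀ c : shaTwo ρ, (∃ (S₁ : Finset (Place K)) (t : Π v : Place K, galoisCohomology (ρ.toLocal v) 1),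
      S₀ ⊆ S₁ ∧
      (∀ v : HeightOneSpectrum (𝓞 K), (Sum.inr v : Place K) ∉ S₁ →
        t (Sum.inr v) ∈ unramifiedSubgroup (GaloisRep.toLocal v ρ) 1) ∧
      ∀ (y : galoisCohomology (ρ.tateDual n) 1) (S' : Finset (Place K)), S₁ ⊆ S' →
        (∀ v : HeightOneSpectrum (𝓞 K), (Sum.inr v : Place K) ∉ S' →
          galoisCohomology.localization (ρ.tateDual n) (Sum.inr v) 1 y ∈
            unramifiedSubgroup (GaloisRep.toLocal v (ρ.tateDual n)) 1) →
        e c y = ∑ v ∈ S', localTatePairingZMod ρ n v (LocalInvariants.canonical K n v) (t v)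
          (galoisCohomology.localization (ρ.tateDual n) v 1 y)) → c = 0 := by
    rintro c ⟨S₁, t, hS₀S₁, htur, hct⟩
    -- `t` is the readout of one `f : N₁ → J̄` (R3)
    obtain ⟨f, hf⟩ := hR3 S₁ (fun w => hS₀S₁ (hinf w)) (fun v hv => hS₀ v fun hv' => hv (hS₀S₁ hv')) t htur
    obtain ⟨Tf, hTf⟩ := hloc f
    -- the functionals of `h_c` and of `f ≫ g` agree
    have hfun : EH (lift c.1 c.2) = EH (f ≫ (ideleClassLimitShortComplex K).g) := by
      ext y
      obtain ⟨S', hS', hy⟩ := hur_y y (S₁ ∪ Tf)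
      have h1 : e c y = ∑ v ∈ S', localTatePairingZMod ρ n v (LocalInvariants.canonical K n v) (t v)
          (galoisCohomology.localization (ρ.tateDual n) v 1 y) :=
        hct y S' (Finset.union_subset_left hS') hy
      have h2 := hTf y S' (Finset.union_subset_right hS') hy
      rw [← heh, ← heh, ← he, h1, h2]
      exact congrArg _ (Finset.sum_congr rfl fun v _ => by rw [hf v])
    have hΨ := hΨ_eq_of_EH _ _ hfun
    rw [hlift, hΨg] at hΨ
    exact Subtype.ext hΨ
  -- (surj): every character of `H¹(K, M^D)` is a readout plus a local sum
  have hsurj : ∀ φ : galoisCohomology (ρ.tateDual n) 1 →+ ZMod n, ∃ (c : shaTwo ρ) (S₁ : Finset (Place K))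
      (t : Π v : Place K, galoisCohomology (ρ.toLocal v) 1),
      ∀ (y : galoisCohomology (ρ.tateDual n) 1) (S' : Finset (Place K)), S₁ ⊆ S' →
        (∀ v : HeightOneSpectrum (𝓞 K), (Sum.inr v : Place K) ∉ S' →
          galoisCohomology.localization (ρ.tateDual n) (Sum.inr v) 1 y ∈
            unramifiedSubgroup (GaloisRep.toLocal v (ρ.tateDual n)) 1) →
        (φ - e c) y = ∑ v ∈ S', localTatePairingZMod ρ n v (LocalInvariants.canonical K n v) (t v)
          (galoisCohomology.localization (ρ.tateDual n) v 1 y) := by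
    intro φ
    -- the character read on `Ext¹(ℤ, N)` through `nat`, as `α¹(∂ h)`
    let Φ : Abelian.Ext (triv (Γ := absoluteGaloisGroup K) ℤ) S.X₃ 1 →+ AddCircle (1 : ℚ) :=
      ((zmodToQmodZ n).comp φ).comp natE.symm.toAddMonoidHom
    have hΦ : ∀ y, Φ (nat y) = zmodToQmodZ n (φ y) := fun y => by
      change zmodToQmodZ n (φ (natE.symm (nat y))) = _
      rw [← hnatE, AddEquiv.symm_apply_apply]
    obtain ⟨x, hx⟩ := hα.2 Φ
    obtain ⟨h, hh⟩ := boundary_surjective hS hPC x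
    have hEHh : ∀ y, EH h y = zmodToQmodZ n (φ y) := fun y => by
      rw [← hΦ, ← hx, ← hh]
      rfl
    let c : shaTwo ρ := ⟨Ψ h, hΨsha h⟩
    have hΨd : Ψ (lift c.1 c.2 - h) = 0 := by rw [map_sub, hlift, sub_self]
    obtain ⟨f, hf⟩ := hΨker _ hΨd
    obtain ⟨Tf, hTf⟩ := hloc (-f)
    refine ⟨c, Tf, fun v => R v (-f), fun y S' hS' hy => ?_⟩
    have hneg : h - lift c.1 c.2 = (-f) ≫ (ideleClassLimitShortComplex K).g := by
      rw [← neg_sub, hf]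
      exact (Preadditive.neg_comp _ _).symm
    -- (rewrite at the level of values: `Hom(N₁, T.X₃)` and `Hom(N₁, C̄)` agree only up to unfolding)
    have key : eh (h - lift c.1 c.2) y = eh ((-f) ≫ (ideleClassLimitShortComplex K).g) y :=
      DFunLike.congr_fun (congrArg eh hneg) y
    rw [← hTf y S' hS' hy, ← key, heh_sub, AddMonoidHom.sub_apply, he]
    congr 1
    apply zmodToQmodZ_injective n
    rw [heh, hEHh]
  -- lead g4's theorem for the canonical family, every number field (archimedean local duality, Milne I 2.13 (a))
  obtain ⟨hfin, b, -, hb, hbflip⟩ :=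
    sha_tateDual_of_readout_real LocalInvariants.canonical_isPerfect LocalInvariants.canonical_injectiveAtRealPlaces
      (unramifiedOrthogonal_of_isPerfect_allLevels _ LocalInvariants.canonical_isPerfect) hcomp ρ hM S₀ hinf hS₀
      e hadd hinj hsurj
  exact ⟨hfin, b, hb, hbflip⟩

end Road

/-! ## §2 The road RUN on door-c4's canonical presentation, any number field -/

section Instantiated

variable {K : Type} [Field K] [NumberField K]

open Literature.NumberTheory.GaloisRepresentations.FreePresentation (presentationComplex presentationComplex_shortExact
  presLattice presentationLayer presentationRank)
open Literature.NumberTheory.GaloisRepresentations.HomDual (IdeleProjection readout)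

/-- **The `Ш²`-readout road on the canonical presentation — ANY number field (real places allowed).**  For a finite
`n`-torsion `ρ₀` on `M₀` with door-c4's presentation `S = presentationComplex ρ₀` (`0 → N₁ → ℤ[Gal(E₀/K)]ᵐ → M₀ → 0`), the
module `ρ := ρ₀^D`, the idèle readout `R_v := HomDual.readout ρ₀ n hM (π v)` of a family `π` of idèle projections (ALL places),
and an invariant map `inv` of `C̄` satisfying door-c4's `TateDualityHypotheses` (record landed as
`IdeleClassBar.tateDualityHypotheses_classBarD_classBarInvD`), `Ext¹(ℤ[Gal(E₀/K)]ᵐ, C̄) = 0` being chl-p2 g6's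
`ext_presLattice_classBarD_eq_zero`: IF (R3) holds for the idèle readout, a bridge `nat : H¹(K, M₀^{DD}) ≅ Ext¹(ℤ, M₀)` satisfies
the (R4) identity (archimedean summands included), a degree-`2` map `Ψ : Hom(N₁, C̄) → H²(K, M₀^D)` has the five properties,
and the canonical invariant maps satisfy `SelmerComplement` at level `n`, THEN `Ш²(K, M₀^D)` is finite and perfectly paired
with `Ш¹(K, M₀^{DD})` into `ℤ/n` — the conclusion of `poitouTate_sha_tateDual K` at the module `ρ₀^D`.  Verbatim
`shaTwo_tateDual_of_ideleProjection` minus `[IsTotallyComplex K]`.  HONEST FRAMING: a reduction; closes nothing.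
[cite: MilneADT2006, Ch. I, Thm. 4.10 (a) (proof, p. 58), Thm. 2.13 (a), Lemma 4.13, Thm. 1.8][cite: Harari2020, Thm. 17.13 (b)] -/
theorem shaTwo_tateDual_of_ideleProjection_real {n : ℕ} [NeZero n]
    (hcomp : (LocalInvariants.canonical K n).SelmerComplement)
    (inv : Abelian.Ext (triv (Γ := absoluteGaloisGroup K) ℤ) (classBarD K) 2 →+ AddCircle (1 : ℚ))
    (hT : TateDualityHypotheses (classBarD K) inv) (π : ∀ v : Place K, IdeleProjection K v)
    {M : Type} [AddCommGroup M] [TopologicalSpace M] [DiscreteTopology M] [Finite M] [Finite (TateDual K M n)]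
    (ρ₀ : DiscreteGaloisModule K M) (hM : ∀ m : M, n • m = 0)
    (S₀ : Finset (Place K)) (hinf : ∀ w : InfinitePlace K, (Sum.inl w : Place K) ∈ S₀)
    (hS₀ : ∀ v : HeightOneSpectrum (𝓞 K), (Sum.inr v : Place K) ∉ S₀ →
      ((n : ℕ) : 𝓞 K) ∉ v.asIdeal ∧ GaloisRep.IsUnramifiedAt v (ρ₀.tateDual n))
    [Finite (sha ((ρ₀.tateDual n).tateDual n))]
    (hR3 : ∀ T : Finset (Place K), (∀ w : InfinitePlace K, (Sum.inl w : Place K) ∈ T) →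
      (∀ v : HeightOneSpectrum (𝓞 K), (Sum.inr v : Place K) ∉ T →
        ((n : ℕ) : 𝓞 K) ∉ v.asIdeal ∧ GaloisRep.IsUnramifiedAt v (ρ₀.tateDual n)) →
      ∀ t : Π v : Place K, galoisCohomology ((ρ₀.tateDual n).toLocal v) 1,
        (∀ v : HeightOneSpectrum (𝓞 K), (Sum.inr v : Place K) ∉ T →
          t (Sum.inr v) ∈ unramifiedSubgroup (GaloisRep.toLocal v (ρ₀.tateDual n)) 1) →
        ∃ f : (presentationComplex ρ₀).X₁ ⟶ (ideleClassLimitShortComplex K).X₂,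
          ∀ v : Place K, readout ρ₀ n hM (π v) f = t v)
    (nat : galoisCohomology ((ρ₀.tateDual n).tateDual n) 1 →+
      Abelian.Ext (triv (Γ := absoluteGaloisGroup K) ℤ) (presentationComplex ρ₀).X₃ 1)
    (hnat : Function.Bijective nat)
    (hR4 : ∀ f : (presentationComplex ρ₀).X₁ ⟶ (ideleClassLimitShortComplex K).X₂, ∃ Tf : Finset (Place K),
      ∀ (y : galoisCohomology ((ρ₀.tateDual n).tateDual n) 1) (T' : Finset (Place K)), Tf ⊆ T' →
        (∀ v : HeightOneSpectrum (𝓞 K), (Sum.inr v : Place K) ∉ T' →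
          galoisCohomology.localization ((ρ₀.tateDual n).tateDual n) (Sum.inr v) 1 y ∈
            unramifiedSubgroup (GaloisRep.toLocal v ((ρ₀.tateDual n).tateDual n)) 1) →
        zmodToQmodZ n (∑ v ∈ T', localTatePairingZMod (ρ₀.tateDual n) n v (LocalInvariants.canonical K n v)
          (readout ρ₀ n hM (π v) f)
          (galoisCohomology.localization ((ρ₀.tateDual n).tateDual n) v 1 y)) =
        inv ((nat y).comp (boundary (presentationComplex_shortExact ρ₀) (classBarD K)
          (f ≫ (ideleClassLimitShortComplex K).g)) (rfl : 1 + 1 = 2)))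
    (Ψ : ((presentationComplex ρ₀).X₁ ⟶ classBarD K) →+ galoisCohomology (ρ₀.tateDual n) 2)
    (hΨg : ∀ f : (presentationComplex ρ₀).X₁ ⟶ (ideleClassLimitShortComplex K).X₂,
      Ψ (f ≫ (ideleClassLimitShortComplex K).g) = 0)
    (hΨf : ∀ q : (presentationComplex ρ₀).X₂ ⟶ classBarD K, Ψ ((presentationComplex ρ₀).f ≫ q) = 0)
    (hΨker : ∀ h : (presentationComplex ρ₀).X₁ ⟶ classBarD K, Ψ h = 0 →
      ∃ f : (presentationComplex ρ₀).X₁ ⟶ (ideleClassLimitShortComplex K).X₂, h = f ≫ (ideleClassLimitShortComplex K).g)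
    (hΨsha : ∀ h : (presentationComplex ρ₀).X₁ ⟶ classBarD K, Ψ h ∈ shaTwo (ρ₀.tateDual n))
    (hΨsurj : ∀ c ∈ shaTwo (ρ₀.tateDual n), ∃ h : (presentationComplex ρ₀).X₁ ⟶ classBarD K, Ψ h = c) :
    Finite (shaTwo (ρ₀.tateDual n)) ∧
      ∃ b : shaTwo (ρ₀.tateDual n) →+ sha ((ρ₀.tateDual n).tateDual n) →+ ZMod n,
        Function.Bijective b ∧ Function.Bijective b.flip := by
  haveI := absoluteGaloisGroup_compactSpace K
  haveI : Finite (presentationComplex ρ₀).X₃.obj.V := ‹Finite M›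
  have hα : Function.Bijective
      (ExtDuality.adjointMap (P := triv (Γ := absoluteGaloisGroup K) ℤ) inv (presentationComplex ρ₀).X₃
        (rfl : 1 + 1 = 2)) :=
    (tateDuality_finite hT (presentationComplex ρ₀).X₃).2.1
  exact shaTwo_tateDual_of_presentation_readout_real hcomp (ρ₀.tateDual n)
    (fun Φ => DiscreteGaloisModule.TateDual.nsmul_eq_zero Φ) S₀ hinf hS₀ inv (presentationComplex_shortExact ρ₀) hα
    (fun x => ext_presLattice_classBarD_eq_zero (presentationLayer ρ₀) (presentationRank ρ₀) x)
    (fun v => readout ρ₀ n hM (π v)) hR3 nat hnat hR4 Ψ hΨg hΨf hΨker hΨsha hΨsurj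

end Instantiated

end Summit.BirchSwinnertonDyer.BirchSwinnertonDyer.Theorems.PoitouTateShaTwoReadout

end
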